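import Summits.QuantumFields.YangMills.Theorems.UnitScaleTiltProp7NestedMeanTowerClosenessT3
import Summits.QuantumFields.YangMills.Theorems.UnitScaleTiltProp7NestedMeanBridge
import HarnessLib

/-!
# Route `UnitScaleTilt`, crux K1 child «MinimiserStabilityRegPr» (stmt-QuantumFields-19200), skeleton v10, stub `stub_existenceMinimalOrbit` (EX), route (α) —
# **R2a′-TOWER (ROW-T), THE GENERAL-`l` ROW: THE NESTED COVARIANT MEAN IS THE CORNER-AXIAL REFERENCE MEAN UP TO `4500L²ε₀` × THE BLOCK MASS.**
# ★px20 g2's guarded induction ✓`Prop7NestedMeanPoincare.norm_ns_sub_refMean_le_of_lt` (✓p663081 §2) with its displayed rows `hT hstep hC hC0 hclose` inhabited at the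
# d = 3 carrier by ✓p664831 (`…NestedMeanTowerClosenessT3`: corner-axial references, `η_j = 4500L²ε₀·Lʲη`, `2Σ_{j<K−n}η_j ≤ 4500L²ε₀`) and the bridge ✓p663081 §1
# `hstep_of_hsucc`: for EVERY gauge parameter `l` and its averaging sequence `ns` (the `h0`∕`hsucc` of ✓`QTwS_gaugeDir_of_avgSeq` VERBATIM), every level `k′ ≤ K − n`:
# **`‖ns_{k′}(y) − (L³)^{−k′}·Σ_{x∈B^{k′}(y)} Ad_{C_{k′,y,x}} l(x)‖ ≤ 4500L²ε₀·(L³)^{−k′}·Σ_{x∈B^{k′}(y)}‖l(x)‖`** on `PlaqSmall (regThreshold F n K ε₀) U₀`, `10⁷L³ε₀ ≤ 1`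
# — the (d2) half of R2q″'s `happrox` (★w5-20520 g7 20:38:45Z (a)); the `ns_{K−n} = 0` case ∘ ✓p656969 is ✓`…TowerClosenessPlug.normSq_toL2S_le_two_mul_of_nsTop_eq_zero`.

Cell `ym3-torus`, width seat `ym3-torus-px11` (gen 2).  THEOREMS ONLY (0 `def`, 0 `sorry`).  `--supports stmt-QuantumFields-19200 --as helper`, count-neutral.
YM₃ on T³ is a ladder rung (R3), not the Clay problem; nothing here claims the stub, the crux, d = 4 or the gap.

WHAT IS PROVED (sorry-free, no definition; ns `…Theorems.Prop7NestedMeanTowerCloseness`): ★★`norm_ns_sub_refMean_le_of_plaqSmall` (all levels `k′ ≤ K − n`),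
★★`norm_nsTop_sub_refMean_le_of_regPr` (top level, `RegPr` binder).  HONEST SCOPE: a composition of ✓p663081 §1∕§2 with ✓p664831; nothing of print asserted beyond their citations.

References: T. Bałaban, CMP **99** (1985) 389–434 [Balaban1985BackgroundPropagators] ((3.19) p.393); CMP **98** (1985) 17–51 [Balaban1985Averaging] ((97) p.32, pp.24–25);
CMP **102** (1985) 277–309 [Balaban1985Variational] ((2) p.278).
-/

set_option autoImplicit false

noncomputable section

open scoped BigOperators Matrix.Norms.L2Operator

namespace Summit.QuantumFields.YangMills.Theorems.Prop7NestedMeanTowerCloseness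

open Literature.MathematicalPhysics.QuantumFieldTheory.Balaban1983to89
open Finset T4Continuum BlockAveraging
open B5Eq118OneStroke (iterBlockOf iterBlock)
open B15DeterminingSets (embIter)
open B7Prop1Explicit (U1 treeWord disp)
open B7Eq78Linearization (conjR)
open B10Eq27TorusAxialLog (holT axialT transl unitsField toUField)
open B7TransferAnalyticMean (meanCLM)
open T3ContinuumYM3Torus
open T3RegularMinimiser (regThreshold)
open T3PrintedRegularMinimiser (RegPr)
open T3SectALandauChart (eta eta_pos bgUnits)
open Summit.QuantumFields.YangMills.Theorems.Prop8Chart (emlIterU)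
open Summit.QuantumFields.YangMills.Theorems.Prop7SymAvgTwSym (holT_mem_U1)
open Summit.QuantumFields.YangMills.Theorems.Prop7NestedMeanPoincare (hstep_of_hsucc norm_ns_sub_refMean_le_of_lt)

section RefMean

variable (F : T3Family) {n K : ℕ}

/-- ★★ **EVERY LEVEL `k′ ≤ K − n`, EVERY `l`**: on the plaquette window (`PlaqSmall (regThreshold F n K ε₀) U₀`, `10⁷L³ε₀ ≤ 1`), for the averaging sequence `ns` of `l` against the
background tower (`h0`∕`hsucc` of ✓`QTwS_gaugeDir_of_avgSeq`), `‖ns_{k′}(y) − (L^d)^{−k′}•Σ_{x∈B^{k′}(y)} Ad_{C_{k′,y,x}} l(x)‖ ≤ 4500L²ε₀·((L^d)^{−k′}·Σ_{x∈B^{k′}(y)}‖l(x)‖)` at the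
corner-axial references `C_{k′,y,x} = (w_x(embIter k′ y))⁻¹·w_x(x)`, `w_x = axialT U₀♭ (corner (B^{K−n} x))` — ✓`norm_ns_sub_refMean_le_of_lt` ∘ ✓`hstep_of_hsucc` ∘ ✓p664831's rows,
partial sums `2Σ_{j<k′}η_j ≤ 2Σ_{j<K−n}η_j ≤ 4500L²ε₀`. [cite: Balaban1985BackgroundPropagators, (3.19) p.393; Balaban1985Averaging, (97) p.32, pp.24-25; Balaban1985Variational, (2) p.278] -/
theorem norm_ns_sub_refMean_le_of_plaqSmall {ε₀ : ℝ} (hε₀ : 0 < ε₀) (hε7 : 10 ^ 7 * (F.L : ℝ) ^ 3 * ε₀ ≤ 1)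
    (U₀ : GaugeField (F.P K) 0 (Matrix.specialUnitaryGroup (Fin 2) ℂ)) (hU : PlaqSmall (regThreshold F n K ε₀) U₀)
    (ns : (j : ℕ) → Site (F.P K) j → Matrix (Fin 2) (Fin 2) ℂ) (l : Site (F.P K) 0 → Matrix (Fin 2) (Fin 2) ℂ) (h0 : ns 0 = l)
    (hsucc : ∀ (j : ℕ) (y : Site (F.P K) (j + 1)), ns (j + 1) y = ns j (emb y) - meanCLM (Idx (F.P K)) (Matrix (Fin 2) (Fin 2) ℂ) fun i : Idx (F.P K) =>
        ns j (emb y) - ((holT (emlIterU j (bgUnits F K U₀)) (emb y) (stairWord i.2.1 (off i.1)) : (Matrix (Fin 2) (Fin 2) ℂ)ˣ) : Matrix (Fin 2) (Fin 2) ℂ) *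
          ns j (transl (emb y) (disp (stairWord i.2.1 (off i.1)))) * (((holT (emlIterU j (bgUnits F K U₀)) (emb y) (stairWord i.2.1 (off i.1)))⁻¹ : (Matrix (Fin 2) (Fin 2) ℂ)ˣ) : Matrix (Fin 2) (Fin 2) ℂ)) :
    ∀ k', k' ≤ K - n → ∀ y : Site (F.P K) k',
      ‖ns k' y - (((((F.P K).L : ℝ) ^ (F.P K).d) ^ k')⁻¹) • ∑ x ∈ iterBlock k' y,
          conjR ((axialT (bgUnits F K U₀) (Site.fibreSite 0 (K - n) (iterBlockOf (K - n) x) fun _ => (⟨0, pow_pos (F.P K).L_pos (K - n)⟩ : Fin ((F.P K).L ^ (K - n))))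
                (embIter k' y))⁻¹ *
            axialT (bgUnits F K U₀) (Site.fibreSite 0 (K - n) (iterBlockOf (K - n) x) fun _ => (⟨0, pow_pos (F.P K).L_pos (K - n)⟩ : Fin ((F.P K).L ^ (K - n)))) x) (l x)‖
        ≤ (4500 * (F.L : ℝ) ^ 2 * ε₀) * ((((((F.P K).L : ℝ) ^ (F.P K).d) ^ k')⁻¹) * ∑ x ∈ iterBlock k' y, ‖l x‖) := by
  intro k' hk' y
  have hk₀ : K - n ≤ (F.P K).m + (F.P K).K := by show K - n ≤ F.m + K; omega
  have hη0 : ∀ j, 0 ≤ 4500 * (F.L : ℝ) ^ 2 * ε₀ * ((F.L : ℝ) ^ j * eta F n K) := fun j => by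
    have := hε₀.le; have := (eta_pos F n K).le; positivity
  have H := norm_ns_sub_refMean_le_of_lt hk₀
    (fun j (y : Site (F.P K) (j + 1)) (i : Idx (F.P K)) => holT (emlIterU j (bgUnits F K U₀)) (emb y) (stairWord i.2.1 (off i.1)))
    (fun j hj y i => holT_mem_U1 (fun b => emlIterU_bgUnits_mem_U1_of_plaqSmall F hε₀ hε7 U₀ hU hj.le b) _ _)
    ns l (fun x => by rw [h0])
    (fun j _ y => hstep_of_hsucc (fun j (y : Site (F.P K) (j + 1)) (i : Idx (F.P K)) => holT (emlIterU j (bgUnits F K U₀)) (emb y) (stairWord i.2.1 (off i.1))) ns hsucc j y)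
    (fun j z x => (axialT (bgUnits F K U₀) (Site.fibreSite 0 (K - n) (iterBlockOf (K - n) x) fun _ => (⟨0, pow_pos (F.P K).L_pos (K - n)⟩ : Fin ((F.P K).L ^ (K - n))))
        (embIter j z))⁻¹ *
      axialT (bgUnits F K U₀) (Site.fibreSite 0 (K - n) (iterBlockOf (K - n) x) fun _ => (⟨0, pow_pos (F.P K).L_pos (K - n)⟩ : Fin ((F.P K).L ^ (K - n)))) x)
    (fun j _ z x => ref_T3_mem_U1 F U₀ j z x) (fun x => ref_T3_zero_self F U₀ x)
    (fun j => 4500 * (F.L : ℝ) ^ 2 * ε₀ * ((F.L : ℝ) ^ j * eta F n K))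
    (hclose_T3 F hε₀ hε7 U₀ hU) k' hk' y
  refine H.trans (mul_le_mul_of_nonneg_right ?_ (mul_nonneg (by positivity) (sum_nonneg fun x _ => norm_nonneg _)))
  calc 2 * ∑ j ∈ range k', 4500 * (F.L : ℝ) ^ 2 * ε₀ * ((F.L : ℝ) ^ j * eta F n K)
      ≤ 2 * ∑ j ∈ range (K - n), 4500 * (F.L : ℝ) ^ 2 * ε₀ * ((F.L : ℝ) ^ j * eta F n K) :=
        mul_le_mul_of_nonneg_left (sum_le_sum_of_subset_of_nonneg (range_mono hk') fun j _ _ => hη0 j) (by norm_num)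
    _ ≤ 4500 * (F.L : ℝ) ^ 2 * ε₀ := two_mul_sum_eta_le_T3 F hε₀.le

/-- ★★ **THE TOP LEVEL ON `𝔘_k(ε₀)`** (★w5-20520 g7's (d2) letter): `RegPr F n K ε₀ U₀`, `10⁷L³ε₀ ≤ 1`, `ns` the averaging sequence of `l` ⟹
`‖ns_{K−n}(y) − (L^d)^{−(K−n)}•Σ_{x∈B^{K−n}(y)} Ad_{C_{K−n,y,x}} l(x)‖ ≤ 4500L²ε₀·((L^d)^{−(K−n)}·Σ_{x∈B^{K−n}(y)}‖l(x)‖)`.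
[cite: Balaban1985BackgroundPropagators, (3.19) p.393; Balaban1985Averaging, (97) p.32; Balaban1985Variational, (2) p.278] -/
theorem norm_nsTop_sub_refMean_le_of_regPr {ε₀ : ℝ} (hε₀ : 0 < ε₀) (hε7 : 10 ^ 7 * (F.L : ℝ) ^ 3 * ε₀ ≤ 1)
    (U₀ : GaugeField (F.P K) 0 (Matrix.specialUnitaryGroup (Fin 2) ℂ)) (hreg : RegPr F n K ε₀ U₀)
    (ns : (j : ℕ) → Site (F.P K) j → Matrix (Fin 2) (Fin 2) ℂ) (l : Site (F.P K) 0 → Matrix (Fin 2) (Fin 2) ℂ) (h0 : ns 0 = l)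
    (hsucc : ∀ (j : ℕ) (y : Site (F.P K) (j + 1)), ns (j + 1) y = ns j (emb y) - meanCLM (Idx (F.P K)) (Matrix (Fin 2) (Fin 2) ℂ) fun i : Idx (F.P K) =>
        ns j (emb y) - ((holT (emlIterU j (bgUnits F K U₀)) (emb y) (stairWord i.2.1 (off i.1)) : (Matrix (Fin 2) (Fin 2) ℂ)ˣ) : Matrix (Fin 2) (Fin 2) ℂ) *
          ns j (transl (emb y) (disp (stairWord i.2.1 (off i.1)))) * (((holT (emlIterU j (bgUnits F K U₀)) (emb y) (stairWord i.2.1 (off i.1)))⁻¹ : (Matrix (Fin 2) (Fin 2) ℂ)ˣ) : Matrix (Fin 2) (Fin 2) ℂ))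
    (y : Site (F.P K) (K - n)) :
    ‖ns (K - n) y - (((((F.P K).L : ℝ) ^ (F.P K).d) ^ (K - n))⁻¹) • ∑ x ∈ iterBlock (K - n) y,
        conjR ((axialT (bgUnits F K U₀) (Site.fibreSite 0 (K - n) (iterBlockOf (K - n) x) fun _ => (⟨0, pow_pos (F.P K).L_pos (K - n)⟩ : Fin ((F.P K).L ^ (K - n))))
              (embIter (K - n) y))⁻¹ *
          axialT (bgUnits F K U₀) (Site.fibreSite 0 (K - n) (iterBlockOf (K - n) x) fun _ => (⟨0, pow_pos (F.P K).L_pos (K - n)⟩ : Fin ((F.P K).L ^ (K - n)))) x) (l x)‖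
      ≤ (4500 * (F.L : ℝ) ^ 2 * ε₀) * ((((((F.P K).L : ℝ) ^ (F.P K).d) ^ (K - n))⁻¹) * ∑ x ∈ iterBlock (K - n) y, ‖l x‖) :=
  norm_ns_sub_refMean_le_of_plaqSmall F hε₀ hε7 U₀ hreg.plaqSmall ns l h0 hsucc (K - n) le_rfl y

end RefMean

end Summit.QuantumFields.YangMills.Theorems.Prop7NestedMeanTowerCloseness

end
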